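import Summits.RiemannHypothesis.RiemannHypothesis.Theorems.UniversalFactorMediumLowWindowA

/-!
# RiemannHypothesis / UniversalFactor — the wide window of `LaplaceLoophole` by certified computation:
one-point Laguerre certificates for `a ∈ [0.300, 0.392698]` (negative-side support for crux `LaplaceLoophole`,
item stmt-RiemannHypothesis-2575; serves `ExceptionalWideNoGo`, stmt-RiemannHypothesis-2583)

Refuter file (compute-scan seat `lscan-RiemannHypothesis-2575`).  TWO `native_decide` evaluations of the
tree's certified one-sided-average checker (`UniversalFactor.osaWindowCheck`,
`UniversalFactorMedium{Defs,BoxDefs,LowDefs}.lean`, soundness `UniversalFactor.osaWindowCheck_sound` in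
`UniversalFactorMediumLowWindowA.lean`), extending the low window A of `MediumKernelNoGo` (hump at `x = 64.6`,
`a ∈ [0.392698, 0.445757]`) DOWN through the edge `π/8` and the residue zero `a₀ = 0.31941502680…` of the
wide window:

* window **D** — DIP certificate at `x = 41.9` (just left of the zero `2γ₂ = 42.044` of `H_0`;
  `H_0(41.9) = −1.687·10⁻⁷ < 0 < P_a(41.9), Q_a(41.9)`), `24 + 24` Gauss–Legendre y-cells, 3 boxes
  `[300000, 312000, 321000, 326000]·10⁻⁶` covering `[0.300, 0.326]` (for `a` near `a₀` the backward average `P_a` is carried by the central bump of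
  `H_0`, `P_a(41.9) ≈ 1.1·10⁻⁵`, and the forward average by the hump `(42.04, 50.02)`, `Q_a ≈ 1.7·10⁻⁶`);
* window **H** — HUMP certificate at the point A `x = 64.6` of the medium window (`H_0(64.6) = 4.09·10⁻¹⁰ > 0`,
  `P_a, Q_a < 0` from `a ≈ 0.3215` on), 8 boxes `[324000, 325300, 327400, 330900, 336600, 346100,
  362200, 390600, 392698]·10⁻⁶` covering `[0.324, 0.392698]`.

The point and box data are written INLINE (no new definitions), so that this file is a pure (computational)
proof file; the dip point is `{ xn := 419, xd := 10, ρ_y = 2, R_y = 12, CyB = CyF = 24, dip := true }`.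

Box tables were designed by emulating `osaBoxCheck` on the engine's own node values (seat folder
`diag/boxdesign.py`, `diag/nodes*.out`) with a 15 % relative reserve; the dip point fails only above `a ≈ 0.335`
(`P_a(41.9)` changes sign) and the hump point only below `a ≈ 0.3215`, so the two windows overlap on
`[0.324, 0.326]`.  Together with the residue-sign cells of `LaplaceLoopholeThetaCells.lean` (`a ≤ 0.3188`:
`Φ_ℂ(ia) > 0`, handled by the PROVED `WideKernelNoGo`) and window A (`a ≥ 0.392698`) this closes the whole wide
window `0 < a < π/8` (assembled in `LaplaceLoopholeWideWindow.lean`).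
-/

set_option linter.dupNamespace false

noncomputable section

namespace Summit.RiemannHypothesis.RiemannHypothesis.Theorems

open MeasureTheory Set
open Literature.NumberTheory.LFunctions
open Literature.Analysis.ValidatedNumerics Literature.Analysis.ValidatedNumerics.NumericsMP

/-- **The certified computation of window D** (`native_decide`): dip point `x = 41.9` (just left of the zero
`2γ₂ = 42.044` of `H_0`), `24 + 24` y-cells of width 4 (`Y = 96`), boxes on `[0.300, 0.326]`. [folklore] -/
theorem UniversalFactor.osaWindowD_check :
    UniversalFactor.osaWindowCheck
      { xn := 419, xd := 10, rhoYn := 2, rhoYd := 1, RYn := 12, RYd := 1, CyB := 24, CyF := 24, dip := true }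
      [300000, 312000, 321000, 326000] = true := by
  native_decide

/-- **The certified computation of window H** (`native_decide`): the hump point A (`x = 64.6`) of the medium
window, boxes on `[0.324, 0.392698]`. [folklore] -/
theorem UniversalFactor.osaWindowH_check :
    UniversalFactor.osaWindowCheck UniversalFactor.osaPtA
      [324000, 325300, 327400, 330900, 336600, 346100, 362200, 390600, 392698] = true := by
  native_decide

/-- **Window D**: every `a ∈ [0.300, 0.326]` has a point `x ≥ 0` (namely `x = 41.9`) with a filled dip or hump of
the one-sided Laplace(`a`) averages of `H_0`. [folklore] -/
theorem UniversalFactor.osaWindowD : ∀ a : ℝ, (300000 : ℝ) / 1000000 ≤ a → a ≤ (326000 : ℝ) / 1000000 →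
    ∃ x : ℝ, 0 ≤ x ∧
      (((deBruijnH 0 x).re < 0 ∧
          0 < (∫ y in Ioi (0:ℝ), deBruijnH 0 ((x : ℂ) - y) * (Real.exp (-(a * y)) : ℂ)).re ∧
          0 < (∫ y in Ioi (0:ℝ), deBruijnH 0 ((x : ℂ) + y) * (Real.exp (-(a * y)) : ℂ)).re) ∨
        (0 < (deBruijnH 0 x).re ∧
          (∫ y in Ioi (0:ℝ), deBruijnH 0 ((x : ℂ) - y) * (Real.exp (-(a * y)) : ℂ)).re < 0 ∧
          (∫ y in Ioi (0:ℝ), deBruijnH 0 ((x : ℂ) + y) * (Real.exp (-(a * y)) : ℂ)).re < 0)) :=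
  fun a h1 h2 => UniversalFactor.osaWindowCheck_sound UniversalFactor.osaWindowD_check
    (by simp) a
    (by simpa [UniversalFactor.osaAD] using h1)
    (by simpa [UniversalFactor.osaAD] using h2)

/-- **Window H**: every `a ∈ [0.324, 0.392698]` has a point `x ≥ 0` (namely `x = 64.6`) with a filled dip or hump
of the one-sided Laplace(`a`) averages of `H_0`. [folklore] -/
theorem UniversalFactor.osaWindowH : ∀ a : ℝ, (324000 : ℝ) / 1000000 ≤ a → a ≤ (392698 : ℝ) / 1000000 →
    ∃ x : ℝ, 0 ≤ x ∧
      (((deBruijnH 0 x).re < 0 ∧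
          0 < (∫ y in Ioi (0:ℝ), deBruijnH 0 ((x : ℂ) - y) * (Real.exp (-(a * y)) : ℂ)).re ∧
          0 < (∫ y in Ioi (0:ℝ), deBruijnH 0 ((x : ℂ) + y) * (Real.exp (-(a * y)) : ℂ)).re) ∨
        (0 < (deBruijnH 0 x).re ∧
          (∫ y in Ioi (0:ℝ), deBruijnH 0 ((x : ℂ) - y) * (Real.exp (-(a * y)) : ℂ)).re < 0 ∧
          (∫ y in Ioi (0:ℝ), deBruijnH 0 ((x : ℂ) + y) * (Real.exp (-(a * y)) : ℂ)).re < 0)) :=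
  fun a h1 h2 => UniversalFactor.osaWindowCheck_sound UniversalFactor.osaWindowH_check
    (by simp) a
    (by simpa [UniversalFactor.osaAD] using h1)
    (by simpa [UniversalFactor.osaAD] using h2)

end Summit.RiemannHypothesis.RiemannHypothesis.Theorems
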